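import Mathlib
import Summits.Ventures.HodgeRepro.Tier4.Target
import Summits.Ventures.HodgeRepro.Tier4.Line3.Defs
import Summits.Ventures.HodgeRepro.Tier4.Line3.DefsLemmas
import Summits.Ventures.HodgeRepro.Tier4.Line3.OffMainOrbit
import Summits.Ventures.HodgeRepro.Tier4.Line3.OrbitInvariant
import Summits.Ventures.HodgeRepro.Tier4.Line3.RayMinor
import Summits.Ventures.HodgeRepro.Tier4.Line3.CrossMinor
import Summits.Ventures.HodgeRepro.Tier4.Line3.BallCoordLemmas
import Summits.Ventures.HodgeRepro.Tier4.Line3.HeckeEquivarianceLemmas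
import Summits.Ventures.HodgeRepro.Tier4.Line3.ScalarFamily

/-!
# Tier4/Line3/RankOneInvariant — L3.4″: the depth-`N` per-slot balls eventually miss every orbit OFF the rank-one ray
(t4-x2 g2; the `OrbitInvariant` pattern (L3.4, p668771) on the DEGREE-4 invariants `crossMinor` of t4-L2-p3 g3's
`CrossMinor` (p679339) and the per-slot support clause `SuppSlot`)

Blind re-derivation cell `pub-hodge-repro`, Tier 4 «PROVE THE STEP» (README §9–§10), LINE L3, seat t4-x2 (reserve
wall-breaker, g2).  For the v0.39 repair of the line after O-L3-8 (S13369 / S13393 / S13421): the support of the natural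
localiser is the product of the four per-slot saturated balls (`SuppSlot`), the persistent orbits are the per-slot scalar
copies of the ray elements (S13421 (3)), and what the degree-4 rung SEES is the set `RankOneRay xm` of orbits all of whose
cross products with the centre vanish.

* `crossMinor_smul` / `absCross_smul`: scaling the four vectors by `t : Fin 4 → E′` multiplies every cross product by
  `c(t_i) t_j c(t_k) t_l` — of absolute value `1` at every embedding for norm-one `t`.
* `crossMinor_unitary`: `U(H)(E′)` does not change the Gram entries, hence not the cross products.
* `absCross_eq_of_orbitOf_eq`: the archimedean sizes `‖σ (crossMinor xm x i j k l)‖` are ORBIT INVARIANTS (induction on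
  `Relation.EqvGen orbitStepL` through the chosen representatives, exactly as `OrbitInvariant.absGram_of_orbitOf_eq`).
* `eventually_coefQ_eq_zero_rankOne`: for a family of translates with the per-slot support clause, every line tuple of a
  fixed orbit OFF `RankOneRay xm` has coefficient `0` from some depth on — otherwise `exists_crossMinor_size` gives
  `N(𝔭)^N ≤ ‖σ D₀‖^d ‖σ M‖^d` with `‖σ M‖` bounded by the orbit's invariants, against `N(𝔭) ≥ 2`.
* `eventually_term_eq_zero_rankOne` / `tendsto_term_zero_rankOne`: the orbital terms off the rank-one ray vanish from
  some depth on, hence tend to `0` — the field `tendsto_zero` of `LocalizerSetOff` (p679551) for `mainSet := RankOneRay xm`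
  (or any main set containing it).

`RankOneRay xm` and `ScalarFamily xm` are `Tier4/Line3/ScalarFamily.lean` (p679898, the text of record of v0.39, S13492 (1)):
the rank-one ray contains the per-slot scalar family and coincides with it off the zero slots when the centre has non-zero Gram
entries; the orbits with a zero slot have kernel `0` (`datumS Φ 0 z k = 0`), so their terms vanish at every depth — which gives
the cut of record **`term_tendsto_zero_family`** (L3.4″ with `o ∉ ScalarFamily xm`).
Nothing here asserts anything about the truth of (P); HC_CM is NOT proved by anyone in this repository.
-/

set_option autoImplicit false

noncomputable section

namespace Summit.Ventures.HodgeRepro.Tier4.Line3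

open Summit.Ventures.HodgeRepro.Tier4
open Matrix NumberField Filter Topology

open scoped Classical

namespace T4Data

variable (X : T4Data)

/-! ### 2. The archimedean sizes of the cross products are orbit invariants -/

/-- Scaling the four vectors multiplies a cross product by `c(t_i) t_j c(t_k) t_l`. -/
theorem crossMinor_smul (xm : X.Tuple) (t : Fin 4 → X.E) (x : X.Tuple) (i j k l : Fin 4) :
    X.crossMinor xm (fun j => t j • x j) i j k l =
      X.c (t i) * t j * (X.c (t k) * t l) * X.crossMinor xm x i j k l := by
  unfold crossMinor
  rw [X.gram_slot_smul x t i j, X.gram_slot_smul x t k l, X.gram_slot_smul x t i l, X.gram_slot_smul x t k j]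
  ring

/-- Scaling by norm-one scalars does not change the archimedean sizes of the cross products. -/
theorem absCross_smul (xm : X.Tuple) (t : Fin 4 → X.E) (ht : ∀ j, X.c (t j) * t j = 1) (x : X.Tuple)
    (σ : X.E →+* ℂ) (i j k l : Fin 4) :
    ‖σ (X.crossMinor xm (fun j => t j • x j) i j k l)‖ = ‖σ (X.crossMinor xm x i j k l)‖ := by
  rw [X.crossMinor_smul xm t x i j k l, map_mul, map_mul, map_mul, map_mul, norm_mul, norm_mul, norm_mul, norm_mul,
    X.norm_embedding_c, X.norm_embedding_c, X.norm_embedding_eq_one_of_torus σ (ht i),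
    X.norm_embedding_eq_one_of_torus σ (ht j), X.norm_embedding_eq_one_of_torus σ (ht k),
    X.norm_embedding_eq_one_of_torus σ (ht l)]
  ring

/-- Moving the tuple by `g ∈ U(H)(E′)` does not change the cross products. -/
theorem crossMinor_unitary (xm : X.Tuple) {g : Matrix (Fin 3) (Fin 3) X.E} (hg : IsUnitaryOf X.c X.H g)
    (x : X.Tuple) (i j k l : Fin 4) :
    X.crossMinor xm (fun j => g *ᵥ x j) i j k l = X.crossMinor xm x i j k l := by
  unfold crossMinor gram
  simp only [X.hform_unitary hg]

/-- The chosen representative of the line tuple of `x` has the cross sizes of `x`. -/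
theorem absCross_rep_lines (xm x : X.Tuple) (σ : X.E →+* ℂ) (i j k l : Fin 4) :
    ‖σ (X.crossMinor xm (X.rep (X.lines x)) i j k l)‖ = ‖σ (X.crossMinor xm x i j k l)‖ := by
  choose t ht hout using fun j => X.lineStep_out (x j)
  have hrep : X.rep (X.lines x) = fun j => t j • x j := by
    funext j
    exact hout j
  rw [hrep]
  exact X.absCross_smul xm t ht x σ i j k l

/-- One step of `U(H)(E′)` on line tuples preserves the cross sizes of the representatives. -/
theorem absCross_of_orbitStepL (xm : X.Tuple) {w w' : X.LineTuple} (h : X.orbitStepL w w') (σ : X.E →+* ℂ)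
    (i j k l : Fin 4) :
    ‖σ (X.crossMinor xm (X.rep w') i j k l)‖ = ‖σ (X.crossMinor xm (X.rep w) i j k l)‖ := by
  obtain ⟨g, hg, hw⟩ := h
  choose t ht hout using fun j => X.lineStep_out (g *ᵥ Quot.out (w j))
  have hrep : X.rep w' = fun j => t j • (g *ᵥ X.rep w j) := by
    funext j
    show Quot.out (w' j) = _
    rw [hw j]
    exact hout j
  rw [hrep, X.absCross_smul xm t ht _ σ i j k l, X.crossMinor_unitary xm hg _ i j k l]

/-- **THE CROSS SIZES ARE ORBIT INVARIANTS.** -/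
theorem absCross_of_orbitOf_eq (xm : X.Tuple) {w w' : X.LineTuple} (h : X.orbitOf w = X.orbitOf w')
    (σ : X.E →+* ℂ) (i j k l : Fin 4) :
    ‖σ (X.crossMinor xm (X.rep w) i j k l)‖ = ‖σ (X.crossMinor xm (X.rep w') i j k l)‖ := by
  have h' : Relation.EqvGen X.orbitStepL w w' := Quot.eqvGen_exact h
  clear h
  induction h' with
  | rel a b hab => exact (X.absCross_of_orbitStepL xm hab σ i j k l).symm
  | refl a => rfl
  | symm a b _ ih => exact ih.symm
  | trans a b c _ _ ih1 ih2 => exact ih1.trans ih2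

/-- A tuple on the orbit `o` has the cross sizes of the chosen representative of `o`. -/
theorem absCross_eq_of_orbitOf_eq (xm x : X.Tuple) (o : X.Orbit) (h : X.orbitOf (X.lines x) = o)
    (σ : X.E →+* ℂ) (i j k l : Fin 4) :
    ‖σ (X.crossMinor xm x i j k l)‖ = ‖σ (X.crossMinor xm (X.rep (Quot.out o)) i j k l)‖ := by
  rw [← X.absCross_rep_lines xm x σ i j k l]
  apply X.absCross_of_orbitOf_eq
  rw [h]
  exact (Quot.out_eq o).symm

/-! ### 3. The cross sizes are BOUNDED on a fixed orbit -/

/-- The crude bound: the sum of all cross sizes of the orbit's chosen representative over all embeddings. -/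
def crossBound (xm : X.Tuple) (o : X.Orbit) : ℝ :=
  ∑ σ' : X.E →+* ℂ, ∑ i' : Fin 4, ∑ j' : Fin 4, ∑ k' : Fin 4, ∑ l' : Fin 4,
    ‖σ' (X.crossMinor xm (X.rep (Quot.out o)) i' j' k' l')‖

/-- On a fixed orbit every cross size is bounded by `crossBound`, uniformly in the tuple and the embedding. -/
theorem norm_crossMinor_le_crossBound (xm : X.Tuple) (o : X.Orbit) (x : X.Tuple) (hx : X.orbitOf (X.lines x) = o)
    (σ : X.E →+* ℂ) (i j k l : Fin 4) : ‖σ (X.crossMinor xm x i j k l)‖ ≤ X.crossBound xm o := by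
  rw [X.absCross_eq_of_orbitOf_eq xm x o hx σ i j k l]
  unfold crossBound
  have hnn : ∀ (σ : X.E →+* ℂ) (i j k l : Fin 4), 0 ≤ ‖σ (X.crossMinor xm (X.rep (Quot.out o)) i j k l)‖ :=
    fun _ _ _ _ _ => norm_nonneg _
  calc ‖σ (X.crossMinor xm (X.rep (Quot.out o)) i j k l)‖
      ≤ ∑ l' : Fin 4, ‖σ (X.crossMinor xm (X.rep (Quot.out o)) i j k l')‖ :=
        Finset.single_le_sum (fun l' _ => hnn σ i j k l') (Finset.mem_univ l)
    _ ≤ ∑ k' : Fin 4, ∑ l' : Fin 4, ‖σ (X.crossMinor xm (X.rep (Quot.out o)) i j k' l')‖ :=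
        Finset.single_le_sum (fun k' _ => Finset.sum_nonneg fun l' _ => hnn σ i j k' l') (Finset.mem_univ k)
    _ ≤ ∑ j' : Fin 4, ∑ k' : Fin 4, ∑ l' : Fin 4, ‖σ (X.crossMinor xm (X.rep (Quot.out o)) i j' k' l')‖ :=
        Finset.single_le_sum
          (fun j' _ => Finset.sum_nonneg fun k' _ => Finset.sum_nonneg fun l' _ => hnn σ i j' k' l')
          (Finset.mem_univ j)
    _ ≤ ∑ i' : Fin 4, ∑ j' : Fin 4, ∑ k' : Fin 4, ∑ l' : Fin 4,
          ‖σ (X.crossMinor xm (X.rep (Quot.out o)) i' j' k' l')‖ :=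
        Finset.single_le_sum
          (fun i' _ => Finset.sum_nonneg fun j' _ => Finset.sum_nonneg fun k' _ =>
            Finset.sum_nonneg fun l' _ => hnn σ i' j' k' l')
          (Finset.mem_univ i)
    _ ≤ ∑ σ' : X.E →+* ℂ, ∑ i' : Fin 4, ∑ j' : Fin 4, ∑ k' : Fin 4, ∑ l' : Fin 4,
          ‖σ' (X.crossMinor xm (X.rep (Quot.out o)) i' j' k' l')‖ :=
        Finset.single_le_sum
          (fun σ' _ => Finset.sum_nonneg fun i' _ => Finset.sum_nonneg fun j' _ =>
            Finset.sum_nonneg fun k' _ => Finset.sum_nonneg fun l' _ => hnn σ' i' j' k' l')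
          (Finset.mem_univ σ)

/-! ### 4. The per-slot balls eventually miss every fixed orbit off the rank-one ray -/

/-- **THE PER-SLOT BALLS EVENTUALLY MISS A FIXED ORBIT OFF THE RANK-ONE RAY.** For a family of translates with the
per-slot support clause (every line tuple with a non-zero coefficient has a representative `x` with `x_j` in the depth-`N`
ball around a scalar copy `lam_j • xm_j ∈ L`, `L` in the finite set `S`), every line tuple of a fixed orbit `o ∉ RankOneRay xm`
has coefficient `0` from some depth on. -/
theorem eventually_coefQ_eq_zero_rankOne (D : X.ThetaData)
    (p : IsDedekindDomain.HeightOneSpectrum (RingOfIntegers X.E))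
    (S : Finset (Submodule (RingOfIntegers X.E) (Fin 3 → X.E))) (hS : ∀ L ∈ S, X.IsLattice L)
    (xm : X.Tuple) (level : ℕ → X.Level) (loc : ∀ N : ℕ, X.Tr (level N))
    (hsupp : ∀ N (w : X.LineTuple), X.coefQ D.cf (loc N) (X.rep w) ≠ 0 →
      ∃ (lam : Fin 4 → X.E) (x : X.Tuple) (L : Submodule (RingOfIntegers X.E) (Fin 3 → X.E)), L ∈ S ∧
        (∀ j, lam j • xm j ∈ L) ∧ (∀ j, x j - lam j • xm j ∈ X.ballIdeal p N • L) ∧ X.lines x = w)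
    (o : X.Orbit) (ho : o ∉ X.RankOneRay xm) :
    ∃ N₀ : ℕ, ∀ N, N₀ ≤ N → ∀ w : X.LineTuple, X.orbitOf w = o → X.coefQ D.cf (loc N) (X.rep w) = 0 := by
  obtain ⟨D₀, hD₀, hrung⟩ := X.exists_crossMinor_size p S (fun L hL => (hS L hL).1) xm
  have hq := X.one_lt_absNorm p
  obtain ⟨N₀, hN₀⟩ := Filter.eventually_atTop.mp
    ((tendsto_pow_atTop_atTop_of_one_lt hq).eventually (eventually_gt_atTop
      ((∑ σ : X.E →+* ℂ, ‖σ (D₀ : X.E)‖ ^ Module.finrank ℚ X.E) * (X.crossBound xm o) ^ Module.finrank ℚ X.E)))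
  refine ⟨N₀, fun N hN w hw => ?_⟩
  by_contra hne
  obtain ⟨lam, x, L, hL, hl, hx, hxw⟩ := hsupp N w hne
  have hxo : X.orbitOf (X.lines x) = o := by rw [hxw, hw]
  have hxne : X.orbitOf (X.lines x) ∉ X.RankOneRay xm := by rw [hxo]; exact ho
  obtain ⟨i, j, k, l, hM⟩ := X.exists_crossMinor_ne_of_not_mem_rankOneRay xm x hxne
  obtain ⟨σ, hσ⟩ := hrung N lam x L hL hl hx i j k l hM
  have hbound := X.norm_crossMinor_le_crossBound xm o x hxo σ i j k l
  have hKσ : ‖σ (D₀ : X.E)‖ ^ Module.finrank ℚ X.E ≤ ∑ σ' : X.E →+* ℂ, ‖σ' (D₀ : X.E)‖ ^ Module.finrank ℚ X.E :=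
    Finset.single_le_sum (f := fun σ' : X.E →+* ℂ => ‖σ' (D₀ : X.E)‖ ^ Module.finrank ℚ X.E)
      (fun σ' _ => pow_nonneg (norm_nonneg _) _) (Finset.mem_univ σ)
  have h1 : ‖σ (D₀ : X.E)‖ ^ Module.finrank ℚ X.E * ‖σ (X.crossMinor xm x i j k l)‖ ^ Module.finrank ℚ X.E ≤
      (∑ σ' : X.E →+* ℂ, ‖σ' (D₀ : X.E)‖ ^ Module.finrank ℚ X.E) * (X.crossBound xm o) ^ Module.finrank ℚ X.E :=
    mul_le_mul hKσ (pow_le_pow_left₀ (norm_nonneg _) hbound _) (pow_nonneg (norm_nonneg _) _)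
      ((pow_nonneg (norm_nonneg _) _).trans hKσ)
  have h2 := hN₀ N hN
  linarith

/-- **OFF THE RANK-ONE RAY THE ORBITAL TERM IS EVENTUALLY ZERO.** -/
theorem eventually_term_eq_zero_rankOne (D : X.ThetaData)
    (p : IsDedekindDomain.HeightOneSpectrum (RingOfIntegers X.E))
    (S : Finset (Submodule (RingOfIntegers X.E) (Fin 3 → X.E))) (hS : ∀ L ∈ S, X.IsLattice L)
    (xm : X.Tuple) (level : ℕ → X.Level) (loc : ∀ N : ℕ, X.Tr (level N))
    (hsupp : ∀ N (w : X.LineTuple), X.coefQ D.cf (loc N) (X.rep w) ≠ 0 →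
      ∃ (lam : Fin 4 → X.E) (x : X.Tuple) (L : Submodule (RingOfIntegers X.E) (Fin 3 → X.E)), L ∈ S ∧
        (∀ j, lam j • xm j ∈ L) ∧ (∀ j, x j - lam j • xm j ∈ X.ballIdeal p N • L) ∧ X.lines x = w)
    (o : X.Orbit) (ho : o ∉ X.RankOneRay xm) :
    ∃ N₀ : ℕ, ∀ N, N₀ ≤ N → X.term D.Φ D.cf (level N) (loc N) o = 0 := by
  obtain ⟨N₀, hN₀⟩ := X.eventually_coefQ_eq_zero_rankOne D p S hS xm level loc hsupp o ho
  refine ⟨N₀, fun N hN => ?_⟩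
  unfold term
  have hz : ∀ z : Fin 2 → ℂ,
      (∑' w : {w : X.LineTuple // X.orbitOf w = o}, X.summand D.Φ D.cf (loc N) w.1 z) = 0 := by
    intro z
    have h0 : ∀ w : {w : X.LineTuple // X.orbitOf w = o}, X.summand D.Φ D.cf (loc N) w.1 z = 0 := by
      intro w
      unfold summand
      rw [hN₀ N hN w.1 w.2, zero_mul]
    simp only [h0, tsum_zero]
  simp only [hz, MeasureTheory.integral_zero]

/-- The orbital terms off the rank-one ray tend to `0` (they are eventually `0`). -/
theorem tendsto_term_zero_rankOne (D : X.ThetaData)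
    (p : IsDedekindDomain.HeightOneSpectrum (RingOfIntegers X.E))
    (S : Finset (Submodule (RingOfIntegers X.E) (Fin 3 → X.E))) (hS : ∀ L ∈ S, X.IsLattice L)
    (xm : X.Tuple) (level : ℕ → X.Level) (loc : ∀ N : ℕ, X.Tr (level N))
    (hsupp : ∀ N (w : X.LineTuple), X.coefQ D.cf (loc N) (X.rep w) ≠ 0 →
      ∃ (lam : Fin 4 → X.E) (x : X.Tuple) (L : Submodule (RingOfIntegers X.E) (Fin 3 → X.E)), L ∈ S ∧
        (∀ j, lam j • xm j ∈ L) ∧ (∀ j, x j - lam j • xm j ∈ X.ballIdeal p N • L) ∧ X.lines x = w)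
    (o : X.Orbit) (ho : o ∉ X.RankOneRay xm) :
    Tendsto (fun N => X.term D.Φ D.cf (level N) (loc N) o) atTop (𝓝 0) := by
  obtain ⟨N₀, hN₀⟩ := X.eventually_term_eq_zero_rankOne D p S hS xm level loc hsupp o ho
  refine tendsto_const_nhds.congr' ?_
  rw [Filter.EventuallyEq, Filter.eventually_atTop]
  exact ⟨N₀, fun N hN => (hN₀ N hN).symm⟩

/-- **L3.4″ ON THE CLAUSE `SuppSlot`**: the orbital terms off the rank-one ray tend to `0`. -/
theorem tendsto_term_zero_of_suppSlot (D : X.ThetaData)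
    (p : IsDedekindDomain.HeightOneSpectrum (RingOfIntegers X.E)) (xm : X.Tuple)
    {level : ℕ → X.Level} (loc : ∀ N : ℕ, X.Tr (level N)) (hsupp : X.SuppSlot D p xm loc)
    (o : X.Orbit) (ho : o ∉ X.RankOneRay xm) :
    Tendsto (fun N => X.term D.Φ D.cf (level N) (loc N) o) atTop (𝓝 0) := by
  obtain ⟨S, hS, hsupp⟩ := hsupp
  refine X.tendsto_term_zero_rankOne D p S (fun L hL => (hS L hL).1) xm level loc (fun N w hw => ?_) o ho
  obtain ⟨lam, x, L, hL, hl, hlines⟩ := hsupp N w hw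
  exact ⟨lam, x, L, hL, fun j => (hl j).2.1, fun j => X.mem_ballIdeal_smul_of_suppU p N (hl j).2.2, hlines⟩

/-! ### 5. Orbits with a zero slot: the kernel vanishes, the term is `0` at every depth -/

/-- The datum vanishes at `y = 0`. -/
theorem datumS_zero (Φ : KMDatumS) (z : Fin 2 → ℂ) (k : Fin 2) : datumS Φ 0 z k = 0 := by
  unfold datumS
  simp

/-- The kernel of a tuple with a zero slot vanishes. -/
theorem kernel_eq_zero_of_zero_slot (Φ : KMDatumS) (x : X.Tuple) (j : Fin 4) (hj : x j = 0) (z : Fin 2 → ℂ) :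
    X.kernel Φ x z = 0 := by
  have hcases : ∀ j : Fin 4, j = 0 ∨ j = 1 ∨ j = 2 ∨ j = 3 := by decide
  unfold kernel
  rcases hcases j with rfl | rfl | rfl | rfl <;> simp [hj, X.ballCoord_zero, datumS_zero, wedge]

/-- `rep w j = 0` exactly when `w j` is the line of `0`. -/
theorem rep_eq_zero_iff (w : X.LineTuple) (j : Fin 4) : X.rep w j = 0 ↔ w j = Quot.mk X.lineStep 0 := by
  constructor
  · intro h
    have : w j = Quot.mk X.lineStep (X.rep w j) := (Quot.out_eq (w j)).symm
    rw [this, h]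
  · intro h
    obtain ⟨t, -, ht⟩ := X.lineStep_out (0 : Fin 3 → X.E)
    show Quot.out (w j) = 0
    rw [h, ht, smul_zero]

/-- A unitary matrix is invertible: `g *ᵥ v = 0 → v = 0`. -/
theorem eq_zero_of_mulVec_eq_zero {g : Matrix (Fin 3) (Fin 3) X.E} (hg : IsUnitaryOf X.c X.H g) {v : Fin 3 → X.E}
    (h : g *ᵥ v = 0) : v = 0 := by
  have hu : IsUnit g.det := HeckeEquivariance.isUnit_det_of_isUnitaryOf X hg
  have : v = g⁻¹ *ᵥ (g *ᵥ v) := by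
    rw [Matrix.mulVec_mulVec, Matrix.nonsing_inv_mul g hu, Matrix.one_mulVec]
  rw [this, h, Matrix.mulVec_zero]

/-- One step of `U(H)(E′)` on line tuples preserves «slot `j` is the zero line». -/
theorem zeroLine_iff_of_orbitStepL {w w' : X.LineTuple} (h : X.orbitStepL w w') (j : Fin 4) :
    w j = Quot.mk X.lineStep 0 ↔ w' j = Quot.mk X.lineStep 0 := by
  obtain ⟨g, hg, hw⟩ := h
  rw [hw j]
  constructor
  · intro h0
    have hrep : Quot.out (w j) = 0 := (X.rep_eq_zero_iff w j).mpr h0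
    rw [hrep, Matrix.mulVec_zero]
  · intro h0
    have hstep := HeckeEquivariance.lineStep_of_mk_eq X h0
    obtain ⟨t, ht, hts⟩ := hstep
    have ht0 : t ≠ 0 := by
      intro h
      rw [h, mul_zero] at ht
      exact zero_ne_one ht
    have hgv : g *ᵥ Quot.out (w j) = 0 := by
      have := hts
      rw [eq_comm] at this
      exact (smul_eq_zero.mp this).resolve_left ht0
    have hrep : Quot.out (w j) = 0 := X.eq_zero_of_mulVec_eq_zero hg hgv
    exact (X.rep_eq_zero_iff w j).mp hrep

/-- **«SLOT `j` IS THE ZERO LINE» IS AN ORBIT INVARIANT.** -/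
theorem zeroLine_iff_of_orbitOf_eq {w w' : X.LineTuple} (h : X.orbitOf w = X.orbitOf w') (j : Fin 4) :
    w j = Quot.mk X.lineStep 0 ↔ w' j = Quot.mk X.lineStep 0 := by
  have h' : Relation.EqvGen X.orbitStepL w w' := Quot.eqvGen_exact h
  clear h
  induction h' with
  | rel a b hab => exact X.zeroLine_iff_of_orbitStepL hab j
  | refl a => exact Iff.rfl
  | symm a b _ ih => exact ih.symm
  | trans a b c _ _ ih1 ih2 => exact ih1.trans ih2

/-- On the orbit of a tuple with a zero slot, every line tuple has the zero line in that slot, hence kernel `0` and the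
orbital term is `0` at every level and translate. -/
theorem term_eq_zero_of_zero_slot (D : X.ThetaData) (x : X.Tuple) (j : Fin 4) (hj : x j = 0) (K : X.Level)
    (γ : X.Tr K) : X.term D.Φ D.cf K γ (X.orbitOf (X.lines x)) = 0 := by
  unfold term
  have hz : ∀ z : Fin 2 → ℂ,
      (∑' w : {w : X.LineTuple // X.orbitOf w = X.orbitOf (X.lines x)}, X.summand D.Φ D.cf γ w.1 z) = 0 := by
    intro z
    have h0 : ∀ w : {w : X.LineTuple // X.orbitOf w = X.orbitOf (X.lines x)}, X.summand D.Φ D.cf γ w.1 z = 0 := by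
      intro w
      have hx0 : X.lines x j = Quot.mk X.lineStep 0 := by
        show Quot.mk X.lineStep (x j) = _
        rw [hj]
      have hw0 : w.1 j = Quot.mk X.lineStep 0 := (X.zeroLine_iff_of_orbitOf_eq w.2.symm j).mp hx0
      have hrep : X.rep w.1 j = 0 := (X.rep_eq_zero_iff w.1 j).mpr hw0
      unfold summand
      rw [X.kernel_eq_zero_of_zero_slot D.Φ (X.rep w.1) j hrep z, mul_zero]
    simp only [h0, tsum_zero]
  simp only [hz, MeasureTheory.integral_zero]

/-! ### 6. L3.4″ of record: the orbital terms OFF THE SCALAR FAMILY tend to `0` -/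

/-- **L3.4″ (t4-plan-3 g3 S13492 (3), the cut of record).** For a family of translates with the per-slot support clause
and a centre with non-zero Gram entries, the orbital term of every orbit OFF the scalar family tends to `0`: off the
rank-one ray by the degree-4 rung, on the rank-one ray but off the family by the zero slot (the kernel vanishes). -/
theorem term_tendsto_zero_family (D : X.ThetaData) {p : IsDedekindDomain.HeightOneSpectrum (RingOfIntegers X.E)}
    {xm : X.Tuple} (hG : ∀ i j, X.gram xm i j ≠ 0) {level : ℕ → X.Level} (loc : ∀ N, X.Tr (level N))
    (hsupp : X.SuppU4 D p xm loc) (o : X.Orbit) (ho : o ∉ X.ScalarFamily xm) :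
    Tendsto (fun N => X.term D.Φ D.cf (level N) (loc N) o) atTop (𝓝 0) := by
  by_cases hR : o ∈ X.RankOneRay xm
  · obtain ⟨x, hxo, j, hj⟩ := X.exists_zero_slot_of_mem_rankOneRay_not_mem_scalarFamily xm hG hR ho
    have h0 : ∀ N, X.term D.Φ D.cf (level N) (loc N) o = 0 := by
      intro N
      rw [← hxo]
      exact X.term_eq_zero_of_zero_slot D x j hj (level N) (loc N)
    simp only [h0]
    exact tendsto_const_nhds
  · exact X.tendsto_term_zero_of_suppSlot D p xm loc hsupp o hR

end T4Data

end Summit.Ventures.HodgeRepro.Tier4.Line3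

end
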